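import Literature.AlgebraicGeometry.Deligne1982.HodgeGroupCommutantHOne
import HarnessLib

/-!
# The classes fixed by the Hodge group are the complex combinations of the Hodge classes (Deligne 1982, I Prop. 3.4)

Family `hodge`, layer `Literature/AlgebraicGeometry/Deligne1982`; theorems only (no definition, no named
fact, D-0026). P. Deligne, *Hodge cycles on abelian varieties*, LNM 900 (1982), I §3, Prop. 3.4 (TeXed
re-edition p. 24): for the Mumford–Tate group `G` of a rational Hodge structure `V` and a rational tensor
`t ∈ T = V^{⊗m₁} ⊗ V^{∨⊗m₂} ⊗ ℚ(1)^{⊗m₃}`, «`t` is fixed by `G⁰` iff it is of type `(0,0)`» (`G⁰` the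
special Mumford–Tate group); over `ℂ` this says that the `G⁰(ℂ)`-fixed vectors of `T ⊗ ℂ` are the
`ℂ`-span of the rational `(0,0)`-classes (descent, proof of 3.4: `G_ℂ` is generated by the conjugates
`σμ`, `σ ∈ Aut(ℂ)`).

On the tree's real carriers, for the Tannaka-free Hodge group `hodgeGroup n X` of a smooth projective
`n`-fold `X/ℂ` (`MotivatedGaloisGroup`: the `g ∈ ∏ₖ GL(Hᵏ(X(ℂ); ℂ))` whose Künneth extension fixes the
rational `(p,p)`-classes of all powers) and the tensor space `T = H²ᵖ(X)`:

* `typeProj_eq_zero_of_forall_hodgeGroup_apply_eq` — a class of `Hᵏ(X(ℂ); ℂ)` fixed by `Hg(X)(ℂ)` has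
  no component of type `(p', q')` with `p' ≠ q'` (it is fixed by the Hodge operator `h₂ ∈ Hg(X)(ℂ)` of
  `HodgeGroupTwistedHodgeOperators`, weight `2^{p'-q'} ≠ 1`); hence `eq_zero_of_forall_hodgeGroup_apply_eq_of_odd`
  (odd degree: only `0` is fixed) and `isOfHodgeType_of_forall_hodgeGroup_apply_eq` (degree `2p`: a
  fixed class is of type `(p,p)`, and so are all its Galois conjugates `σ_* c`);
* **`mem_span_hodgeClasses_of_forall_hodgeGroup_apply_eq`** — a class of `H²ᵖ(X(ℂ); ℂ)` fixed by
  `Hg(X)(ℂ)` lies in the `ℂ`-span of the RATIONAL classes of type `(p,p)` (Galois descent over `ℂ`,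
  `Complex.submodule_le_span_fixed_of_forall_ringEquiv`); with the definitional converse
  (`apply_eq_self_of_mem_hodgeGroup`) this is the equality
  **`(H²ᵖ(X(ℂ); ℂ))^{Hg(X)(ℂ)} = (Hodge classes) ⊗ ℂ`** (`forall_hodgeGroup_apply_eq_iff_mem_span_hodgeClasses`)
  — in particular the tree's Tannaka-free `hodgeGroup` has EXACTLY the invariants of Deligne's `G⁰` in
  `H²ᵖ`.

## References

* [Deligne1982HodgeCycles] P. Deligne, *Hodge cycles on abelian varieties*, LNM 900 (1982), I §3,
  Prop. 3.4 and its proof.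
* [Borel1991] A. Borel, *Linear Algebraic Groups*, 2nd ed. (1991), AG §14.2 (Galois descent of
  subspaces).
-/

noncomputable section

open CategoryTheory Cardinal
open scoped TensorProduct
open Literature.AlgebraicTopology.SingularHomology
open Literature.AlgebraicGeometry.HodgeTheory Literature.AlgebraicGeometry.Motives
open Literature.FieldTheory.AlgClosed

namespace Literature.AlgebraicGeometry.Deligne1982

section HodgeTheory

variable {n : ℕ} {X : SchemeOver ℂ}

/-- **A class fixed by the Hodge group has no components of type `(p', q')`, `p' ≠ q'`**: it is fixed by
the Hodge operator `h₂ ∈ Hg(X)(ℂ)`, which multiplies the `(p',q')`-component by `2^{p'-q'} ≠ 1`.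
[cite: Deligne1982HodgeCycles, I §3, Prop. 3.4] -/
theorem typeProj_eq_zero_of_forall_hodgeGroup_apply_eq (M : HodgeModel n X) (hX : IsSmoothProjective n X)
    {k : ℕ} {c : complexBetti X k} (hc : ∀ g ∈ hodgeGroup n X, g k c = c)
    (pq : ↥(Finset.HasAntidiagonal.antidiagonal k)) (hpq : pq.1.1 ≠ pq.1.2) : M.typeProj k pq c = 0 := by
  classical
  set t : ℂˣ := Units.mk0 (2 : ℂ) two_ne_zero with ht
  -- `h₂ c = c`
  have hfix : M.hodgeOperator t k c = c := by
    have h := hc _ (M.hodgeOperator_mem_hodgeGroup hX t)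
    rw [M.twistedHodgeOperator_refl] at h
    exact h
  -- the `(p',q')`-component of `h₂ c` is `w • π c`
  have hproj : M.typeProj k pq (M.hodgeOperator t k c) = HodgeModel.hodgeWeight t pq • M.typeProj k pq c := by
    refine M.typeProj_eq_of_sum_eq (fun pq' ↦ Submodule.smul_mem _ _ (M.typeProj_mem k pq' c)) ?_ pq
    rw [HodgeModel.hodgeOperator, LinearMap.sum_apply]
    exact Finset.sum_congr rfl fun pq' _ ↦ by rw [LinearMap.smul_apply]
  rw [hfix] at hproj
  have e : (HodgeModel.hodgeWeight t pq - 1) • M.typeProj k pq c = 0 := by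
    rw [sub_smul, one_smul, ← hproj, sub_self]
  rcases smul_eq_zero.1 e with hw | hz
  · -- `w_{(p',q')} = 1 = w_{(m,m)}` is impossible for `p' ≠ q'`: compare with the weight of `(0,0)` shifted…
    -- directly: `2^{p'} 2^{-q'} = 1` forces `p' = q'`
    exfalso
    apply hpq
    have hw' : (2 : ℂ) ^ pq.1.1 * (2 : ℂ)⁻¹ ^ pq.1.2 = 1 := by
      simpa [HodgeModel.hodgeWeight, Units.val_inv_eq_inv_val, ht, sub_eq_zero] using hw
    have key : (2 : ℂ) ^ pq.1.1 = (2 : ℂ) ^ pq.1.2 := by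
      have e2 := congrArg (fun z : ℂ ↦ z * (2 : ℂ) ^ pq.1.2) hw'
      simpa [mul_assoc, ← mul_pow, inv_mul_cancel₀ (two_ne_zero : (2 : ℂ) ≠ 0)] using e2
    have hnat : ((2 ^ pq.1.1 : ℕ) : ℂ) = ((2 ^ pq.1.2 : ℕ) : ℂ) := by push_cast; exact key
    exact Nat.pow_right_injective (le_refl 2) (Nat.cast_injective hnat)
  · exact hz

/-- **In odd degree only `0` is fixed by the Hodge group** (no type `(p,p)` on an odd antidiagonal).
[cite: Deligne1982HodgeCycles, I §3, Prop. 3.4] -/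
theorem eq_zero_of_forall_hodgeGroup_apply_eq_of_odd (hX : IsSmoothProjective n X) {k : ℕ} (hk : Odd k)
    {c : complexBetti X k} (hc : ∀ g ∈ hodgeGroup n X, g k c = c) : c = 0 := by
  obtain ⟨M⟩ := nonempty_hodgeModel_holds hX
  rw [← M.sum_typeProj k c]
  refine Finset.sum_eq_zero fun pq _ ↦ typeProj_eq_zero_of_forall_hodgeGroup_apply_eq M hX hc pq fun h ↦ ?_
  have hk' := Finset.HasAntidiagonal.mem_antidiagonal.1 pq.2
  rw [h] at hk'
  exact Nat.not_even_iff_odd.2 hk ⟨pq.1.2, hk'.symm⟩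

/-- **A class of `H²ᵖ(X(ℂ); ℂ)` fixed by the Hodge group is of Hodge type `(p, p)`** (read in any model:
all other components vanish). [cite: Deligne1982HodgeCycles, I §3, Prop. 3.4] -/
theorem mem_typePiece_of_forall_hodgeGroup_apply_eq (M : HodgeModel n X) (hX : IsSmoothProjective n X)
    {p : ℕ} {c : complexBetti X (2 * p)} (hc : ∀ g ∈ hodgeGroup n X, g (2 * p) c = c) :
    c ∈ M.typePiece (2 * p) ⟨(p, p), Finset.HasAntidiagonal.mem_antidiagonal.2 (by omega)⟩ := by
  classical
  set pp : ↥(Finset.HasAntidiagonal.antidiagonal (2 * p)) :=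
    ⟨(p, p), Finset.HasAntidiagonal.mem_antidiagonal.2 (by omega)⟩ with hpp
  have hc' : c = M.typeProj (2 * p) pp c := by
    conv_lhs => rw [← M.sum_typeProj (2 * p) c]
    rw [Finset.sum_eq_single pp]
    · intro pq _ hne
      refine typeProj_eq_zero_of_forall_hodgeGroup_apply_eq M hX hc pq fun h ↦ hne ?_
      have hk := Finset.HasAntidiagonal.mem_antidiagonal.1 pq.2
      exact Subtype.ext (Prod.ext (by simp [hpp]; omega) (by simp [hpp]; omega))
    · exact fun h ↦ absurd (Finset.mem_univ pp) h
  rw [hc']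
  exact M.typeProj_mem _ pp c

/-- A class of `H²ᵖ(X(ℂ); ℂ)` fixed by the Hodge group is of Hodge type `(p, p)`.
[cite: Deligne1982HodgeCycles, I §3, Prop. 3.4] -/
theorem isOfHodgeType_of_forall_hodgeGroup_apply_eq (hX : IsSmoothProjective n X) {p : ℕ}
    {c : complexBetti X (2 * p)} (hc : ∀ g ∈ hodgeGroup n X, g (2 * p) c = c) :
    IsOfHodgeType n X (2 * p) p p c := by
  obtain ⟨M⟩ := nonempty_hodgeModel_holds hX
  have h := mem_typePiece_of_forall_hodgeGroup_apply_eq M hX hc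
  rw [M.mem_typePiece_iff_isOfHodgeType' hX] at h
  exact h

/-- The Galois conjugates `σ_* c` of a class fixed by the Hodge group are fixed by the Hodge group
(`Hg(X)(ℂ) ∋ σ_* h σ⁻¹_*`-stability is built into the twisted operators: `g (σ_* c) = σ_* c` for the
twisted Hodge operators suffices for the type statement) — here in the form needed below: `σ_* c` is of
type `(p, p)` for every field automorphism `σ`. [cite: Deligne1982HodgeCycles, I §3, proof of Prop. 3.4] -/
theorem coeffClass_mem_typePiece_of_forall_hodgeGroup_apply_eq (M : HodgeModel n X)
    (hX : IsSmoothProjective n X) {p : ℕ} {c : complexBetti X (2 * p)}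
    (hc : ∀ g ∈ hodgeGroup n X, g (2 * p) c = c) (σ : ℂ ≃+* ℂ) :
    coeffClass (R := ℂ) (S := ℂ) σ.toRingHom.toAddMonoidHom (2 * p) c ∈
      M.typePiece (2 * p) ⟨(p, p), Finset.HasAntidiagonal.mem_antidiagonal.2 (by omega)⟩ := by
  classical
  set t : ℂˣ := Units.mk0 (2 : ℂ) two_ne_zero with ht
  have htv : (t : ℂ) = 2 := rfl
  set pp : ↥(Finset.HasAntidiagonal.antidiagonal (2 * p)) :=
    ⟨(p, p), Finset.HasAntidiagonal.mem_antidiagonal.2 (by omega)⟩ with hpp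
  -- `h_t (σ_* c) = σ_* c`: apply the twisted operator `σ_* h_t σ⁻¹_* ∈ Hg` to `c`... via its conjugate:
  -- `(σ_* h σ⁻¹_*) (σ_* c') = σ_* (h c')` with `c' = c`? We use the operator twisted by `σ` on `σ_* c`.
  have h := hc _ (M.twistedHodgeOperator_mem_hodgeGroup hX σ t)
  -- `σ_* (h_t (σ⁻¹_* ... ))`: evaluate at `c`
  change M.twistedHodgeOperator σ t (2 * p) c = c at h
  rw [M.twistedHodgeOperator_apply] at h
  -- apply `σ⁻¹_*`... we want the statement for `σ_* c`; replace `σ` by `σ⁻¹`: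
  have h' := hc _ (M.twistedHodgeOperator_mem_hodgeGroup hX σ.symm t)
  change M.twistedHodgeOperator σ.symm t (2 * p) c = c at h'
  rw [M.twistedHodgeOperator_apply, RingEquiv.symm_symm] at h'
  -- `h' : σ⁻¹_* (h_t (σ_* c)) = c`, hence `h_t (σ_* c) = σ_* c`
  have hfix : M.hodgeOperator t (2 * p) (coeffClass (R := ℂ) (S := ℂ) σ.toRingHom.toAddMonoidHom (2 * p) c) =
      coeffClass (R := ℂ) (S := ℂ) σ.toRingHom.toAddMonoidHom (2 * p) c := by
    have e := congrArg (coeffClass (R := ℂ) (S := ℂ) σ.toRingHom.toAddMonoidHom (2 * p)) h'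
    rwa [coeffClass_ringEquiv_apply_symm] at e
  refine mem_typePiece_of_hodgeOperator_eq_smul M t (pq := pp) ?_ (fun pq' e ↦ hodgeWeight_two_injective t htv e)
  rw [hfix]
  have hw : HodgeModel.hodgeWeight t pp = 1 := by
    simp [HodgeModel.hodgeWeight, hpp]
  rw [hw, one_smul]

/-- **Deligne I Prop. 3.4 for the tensor space `H²ᵖ(X)`, on the real carriers: a class of
`H²ᵖ(X(ℂ); ℂ)` fixed by the Hodge group `Hg(X)(ℂ)` lies in the `ℂ`-span of the rational classes of
Hodge type `(p, p)`.** In a rational basis the coordinate vectors of the classes all of whose Galois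
conjugates are of type `(p,p)` form an `Aut(ℂ)`-stable subspace of `ℂ^ι`, spanned by its rational vectors
(`Complex.submodule_le_span_fixed_of_forall_ringEquiv`, `ℂ^{Aut(ℂ)} = ℚ`), which are rational
`(p,p)`-classes. [cite: Deligne1982HodgeCycles, I §3, Prop. 3.4 and its proof] [cite: Borel1991, AG §14.2] -/
theorem mem_span_hodgeClasses_of_forall_hodgeGroup_apply_eq (hX : IsSmoothProjective n X) {p : ℕ}
    {c : complexBetti X (2 * p)} (hc : ∀ g ∈ hodgeGroup n X, g (2 * p) c = c) :
    c ∈ Submodule.span ℂ {c' : complexBetti X (2 * p) | IsRationalClass c' ∧ IsOfHodgeType n X (2 * p) p p c'} := by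
  classical
  obtain ⟨M⟩ := nonempty_hodgeModel_holds hX
  set pp : ↥(Finset.HasAntidiagonal.antidiagonal (2 * p)) :=
    ⟨(p, p), Finset.HasAntidiagonal.mem_antidiagonal.2 (by omega)⟩ with hpp
  -- a rational basis
  haveI : Module.Finite ℚ (bettiCohomology X (2 * p)) := finite_singularCohomology_rat_complexPoints hX (2 * p)
  set β := ofRatClassBaseChangeEquiv hX (2 * p) with hβdef
  set d := Module.finrank ℚ (bettiCohomology X (2 * p)) with hd
  let b : Module.Basis (Fin d) ℚ (bettiCohomology X (2 * p)) := Module.finBasis ℚ (bettiCohomology X (2 * p))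
  let Bc : Module.Basis (Fin d) ℂ (ℂ ⊗[ℚ] bettiCohomology X (2 * p)) := Algebra.TensorProduct.basis ℂ b
  let B : Module.Basis (Fin d) ℂ (complexBetti X (2 * p)) := Bc.map β
  have hBc : ∀ i, Bc i = (1 : ℂ) ⊗ₜ b i := fun i ↦ Algebra.TensorProduct.basis_apply b i
  have hB : ∀ i, B i = ofRatClass (ComplexPoints X) (2 * p) (b i) := fun i ↦ by
    change β (Bc i) = _
    rw [hBc, hβdef, ofRatClassBaseChangeEquiv_apply, ofRatClassBaseChange_tmul, one_smul]
  have hBrat : ∀ i, IsRationalClass (B i) := fun i ↦ by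
    rw [hB]; exact isRationalClass_ofRatClass _
  -- twisted classes in coordinates: `σ_* (Σ vᵢ Bᵢ) = Σ σ(vᵢ) Bᵢ`
  have htw : ∀ (σ : ℂ →+* ℂ) (v : Fin d → ℂ),
      coeffClass (R := ℂ) (S := ℂ) σ.toAddMonoidHom (2 * p) (B.equivFun.symm v) =
        B.equivFun.symm (⇑σ ∘ v) := by
    intro σ v
    rw [B.equivFun_symm_apply, B.equivFun_symm_apply, map_sum]
    exact Finset.sum_congr rfl fun j _ ↦ by
      rw [coeffClass_ringHom_smul, (hBrat j).coeffClass_ringHom_eq σ, Function.comp_apply]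
  -- the stable subspace of coordinate vectors
  let S : Submodule ℂ (Fin d → ℂ) :=
    { carrier := {v | ∀ σ : ℂ ≃+* ℂ, B.equivFun.symm (⇑σ ∘ v) ∈ M.typePiece (2 * p) pp}
      add_mem' := fun {v v'} hv hv' σ ↦ by
        have e : (⇑σ ∘ (v + v')) = (⇑σ ∘ v) + (⇑σ ∘ v') := funext fun i ↦ map_add σ _ _
        rw [e, map_add]
        exact Submodule.add_mem _ (hv σ) (hv' σ)
      zero_mem' := fun σ ↦ by
        have e : (⇑σ ∘ (0 : Fin d → ℂ)) = 0 := funext fun i ↦ map_zero σ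
        rw [e, map_zero]
        exact Submodule.zero_mem _
      smul_mem' := fun a v hv σ ↦ by
        have e : (⇑σ ∘ (a • v)) = σ a • (⇑σ ∘ v) := funext fun i ↦ map_mul σ _ _
        rw [e, map_smul]
        exact Submodule.smul_mem _ _ (hv σ) }
  have hS_mem : ∀ v, v ∈ S ↔ ∀ σ : ℂ ≃+* ℂ, B.equivFun.symm (⇑σ ∘ v) ∈ M.typePiece (2 * p) pp :=
    fun v ↦ Iff.rfl
  have hS : ∀ ρ : ℂ ≃+* ℂ, ∀ v ∈ S, (⇑ρ ∘ v) ∈ S := by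
    intro ρ v hv
    rw [hS_mem]
    intro σ
    have e : (⇑σ ∘ (⇑ρ ∘ v)) = (⇑(ρ.trans σ) ∘ v) := rfl
    rw [e]
    exact (hS_mem v).1 hv (ρ.trans σ)
  -- the coordinates of `c` lie in `S`
  have hcS : B.equivFun c ∈ S := by
    rw [hS_mem]
    intro σ
    have e := htw σ.toRingHom (B.equivFun c)
    rw [LinearEquiv.symm_apply_apply] at e
    have e' : (⇑σ.toRingHom ∘ B.equivFun c) = (⇑σ ∘ B.equivFun c) := rfl
    rw [e'] at e
    rw [← e]
    exact coeffClass_mem_typePiece_of_forall_hodgeGroup_apply_eq M hX hc σ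
  -- Galois descent
  set F : Subfield ℂ := (Rat.castHom ℂ).fieldRange with hF
  have hFcount : #F ≤ ℵ₀ := by
    rw [Cardinal.mk_le_aleph0_iff, hF]
    exact (Set.countable_range (Rat.castHom ℂ)).to_subtype
  have hdesc := Complex.submodule_le_span_fixed_of_forall_ringEquiv F hFcount S
    (fun ρ _ v hv ↦ hS ρ v hv) hcS
  -- push through `B.equivFun.symm`
  have hc_eq : c = B.equivFun.symm (B.equivFun c) := (B.equivFun.symm_apply_apply c).symm
  rw [hc_eq]
  have hmap := Submodule.mem_map_of_mem (f := (B.equivFun.symm : (Fin d → ℂ) →ₗ[ℂ] complexBetti X (2 * p))) hdesc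
  rw [Submodule.map_span] at hmap
  refine Submodule.span_mono ?_ hmap
  rintro _ ⟨v, ⟨hvS, hvF⟩, rfl⟩
  -- a rational vector: `Σ vᵢ Bᵢ = ofRatClass (Σ qᵢ bᵢ)` is rational, and of type `(p,p)` (`σ = 1`)
  have hq : ∀ i, ∃ q : ℚ, (q : ℂ) = v i := fun i ↦ by
    obtain ⟨q, hq⟩ := RingHom.mem_fieldRange.1 (hF ▸ hvF i)
    exact ⟨q, hq⟩
  choose q hq using hq
  refine ⟨?_, ?_⟩
  · have e : (B.equivFun.symm : (Fin d → ℂ) →ₗ[ℂ] complexBetti X (2 * p)) v =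
        ofRatClass (ComplexPoints X) (2 * p) (∑ i, q i • b i) := by
      rw [LinearEquiv.coe_coe, B.equivFun_symm_apply, map_sum]
      exact Finset.sum_congr rfl fun i _ ↦ by rw [ofRatClass_smul, hq, hB]
    rw [e]
    exact isRationalClass_ofRatClass _
  · have h1 := (hS_mem v).1 hvS (RingEquiv.refl ℂ)
    exact (M.mem_typePiece_iff_isOfHodgeType' hX pp _).1 h1

/-- The definitional converse: the `ℂ`-span of the rational `(p,p)`-classes is fixed by the Hodge group.
[cite: Deligne1982HodgeCycles, I §3 (special Mumford–Tate group, before Thm. 3.8)] -/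
theorem hodgeGroup_apply_eq_of_mem_span_hodgeClasses {p : ℕ} {c : complexBetti X (2 * p)}
    (hc : c ∈ Submodule.span ℂ {c' : complexBetti X (2 * p) | IsRationalClass c' ∧ IsOfHodgeType n X (2 * p) p p c'})
    {g : ∀ k : ℕ, complexBetti X k ≃ₗ[ℂ] complexBetti X k} (hg : g ∈ hodgeGroup n X) : g (2 * p) c = c := by
  induction hc using Submodule.span_induction with
  | mem x hx => exact apply_eq_self_of_mem_hodgeGroup hg hx.1 hx.2
  | zero => exact map_zero _
  | add x y _ _ hx hy => rw [map_add, hx, hy]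
  | smul a x _ hx => rw [map_smul, hx]

/-- **`(H²ᵖ(X(ℂ); ℂ))^{Hg(X)(ℂ)} = (Hodge classes) ⊗ ℂ`** (Deligne I Prop. 3.4 for `T = H²ᵖ`, on the
tree's carriers): a class is fixed by every element of the Hodge group iff it is a `ℂ`-combination of
rational classes of Hodge type `(p, p)`. [cite: Deligne1982HodgeCycles, I §3, Prop. 3.4] -/
theorem forall_hodgeGroup_apply_eq_iff_mem_span_hodgeClasses (hX : IsSmoothProjective n X) {p : ℕ}
    (c : complexBetti X (2 * p)) :
    (∀ g ∈ hodgeGroup n X, g (2 * p) c = c) ↔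
      c ∈ Submodule.span ℂ {c' : complexBetti X (2 * p) | IsRationalClass c' ∧ IsOfHodgeType n X (2 * p) p p c'} :=
  ⟨mem_span_hodgeClasses_of_forall_hodgeGroup_apply_eq hX,
    fun hc _ hg ↦ hodgeGroup_apply_eq_of_mem_span_hodgeClasses hc hg⟩

end HodgeTheory

end Literature.AlgebraicGeometry.Deligne1982

end
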